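import Mathlib
import Summits.AtomisticToContinuum.FouriersLaw.Theses.EmbeddedDrudeMourre
import Summits.AtomisticToContinuum.FouriersLaw.Theorems.EmbeddedDrudeMourreDrudeDissolutionStubExcursionSecondDifferenceGradientFloorCorner
import Literature.Barriers.CriticalPhenomena.LongRangeTrivialityOnZ3InfraredBound
import HarnessLib

/-!
# The corner gradient floor in "distance-function" form
# (stub B1b″ of line `kinetic-polymer-gas-on-the-time-axis`, request R3 of the sup-norm engine)
(crux `EmbeddedDrudeMourre.DrudeDissolution`, item stmt-AtomisticToContinuum-12593; `--supports` file, closes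
nothing; lead c13)

WHAT. With `Ω p = resonanceFn ω₂ p.1 p.2.2 p.2.1`, `D p = Σⱼ (fderiv Ω p eⱼ)²` over the coordinate frame and the two
smooth periodic corner distances `d₋ p = (1 − cos p.1) + (1 − cos p.2.2) + (1 + cos p.2.1)` (vanishing exactly on the
lattice of extremal corners `(0,π,0) + 2πℤ³`, the minima of `Ω`) and `d₊ p = (1 + cos p.1) + (1 + cos p.2.2) + (1 − cos p.2.1)`
(the maxima `(π,0,π) + 2πℤ³`): there are `r₁, c₁ > 0` with
`d₋ p < r₁ → c₁·d₋ p ≤ D p` (`corner_floor_dminus`) and `d₊ p < r₁ → c₁·d₊ p ≤ D p` (`corner_floor_dplus`), for ALL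
`p ∈ ℝ³`.

HOW. `resonanceFn_gradient_floor_corner` (p153099) gives `c‖p − p₀‖∞ ≤ ‖fderiv Ω p‖` on sup-norm balls around every
lattice corner `p₀`; Jordan's inequality `2x²/π² ≤ 1 − cos x` (`|x| ≤ π`, after reducing each coordinate mod `2π`)
(`LongRangeIsing.two_mul_sq_div_le_one_sub_cos`) converts `d∓ < r₁ = 2r²/π²` into `‖p − p₀‖∞ < r`, `1 − cos x ≤ x²/2` gives `d∓ ≤ (3/2)‖p − p₀‖∞²`, and
`‖L‖ ≤ |L e₁| + |L e₂| + |L e₃|` gives `‖fderiv Ω p‖² ≤ 3·D p`.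
-/

noncomputable section

open Set Real Topology
open Literature.MathematicalPhysics.KineticTheory
open Literature.MathematicalPhysics.KineticTheory.PhononBoltzmann

namespace Summit.AtomisticToContinuum.FouriersLaw.Theorems.DrudeDissolution.KineticPolymerGasOnTheTimeAxis

/-- The operator norm of a functional on `ℝ × ℝ × ℝ` (sup norm) is at most the sum of the absolute values of its
values on the coordinate frame. [folklore] -/
theorem opNorm_le_sum_abs_basis (L : ℝ × ℝ × ℝ →L[ℝ] ℝ) :
    ‖L‖ ≤ |L (1, 0, 0)| + |L (0, 1, 0)| + |L (0, 0, 1)| := by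
  refine ContinuousLinearMap.opNorm_le_bound L (by positivity) fun x => ?_
  obtain ⟨a, b, c⟩ := x
  have hx : ((a, b, c) : ℝ × ℝ × ℝ) = a • ((1, 0, 0) : ℝ × ℝ × ℝ) + b • ((0, 1, 0) : ℝ × ℝ × ℝ) +
      c • ((0, 0, 1) : ℝ × ℝ × ℝ) := by ext <;> simp
  have hL : L (a, b, c) = a * L (1, 0, 0) + b * L (0, 1, 0) + c * L (0, 0, 1) := by
    conv_lhs => rw [hx]
    simp only [map_add, map_smul, smul_eq_mul]
  have hn : ‖((a, b, c) : ℝ × ℝ × ℝ)‖ = max |a| (max |b| |c|) := by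
    simp [Prod.norm_def, Real.norm_eq_abs]
  rw [Real.norm_eq_abs, hL, hn]
  have ha : |a| ≤ max |a| (max |b| |c|) := le_max_left _ _
  have hb : |b| ≤ max |a| (max |b| |c|) := le_trans (le_max_left _ _) (le_max_right _ _)
  have hc : |c| ≤ max |a| (max |b| |c|) := le_trans (le_max_right _ _) (le_max_right _ _)
  calc |a * L (1, 0, 0) + b * L (0, 1, 0) + c * L (0, 0, 1)|
      ≤ |a * L (1, 0, 0)| + |b * L (0, 1, 0)| + |c * L (0, 0, 1)| := abs_add_three _ _ _
    _ = |a| * |L (1, 0, 0)| + |b| * |L (0, 1, 0)| + |c| * |L (0, 0, 1)| := by simp only [abs_mul]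
    _ ≤ max |a| (max |b| |c|) * |L (1, 0, 0)| + max |a| (max |b| |c|) * |L (0, 1, 0)| +
        max |a| (max |b| |c|) * |L (0, 0, 1)| := by
        gcongr
    _ = (|L (1, 0, 0)| + |L (0, 1, 0)| + |L (0, 0, 1)|) * max |a| (max |b| |c|) := by ring

/-- `‖L‖² ≤ 3·((L e₁)² + (L e₂)² + (L e₃)²)` for a functional on `ℝ × ℝ × ℝ`. [folklore] -/
theorem opNorm_sq_le_three_mul_sum_sq (L : ℝ × ℝ × ℝ →L[ℝ] ℝ) :
    ‖L‖ ^ 2 ≤ 3 * ((L (1, 0, 0)) ^ 2 + (L (0, 1, 0)) ^ 2 + (L (0, 0, 1)) ^ 2) := by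
  have h := opNorm_le_sum_abs_basis L
  have h0 : 0 ≤ ‖L‖ := norm_nonneg _
  have h1 : ‖L‖ ^ 2 ≤ (|L (1, 0, 0)| + |L (0, 1, 0)| + |L (0, 0, 1)|) ^ 2 := pow_le_pow_left₀ h0 h 2
  have h2 : (|L (1, 0, 0)| + |L (0, 1, 0)| + |L (0, 0, 1)|) ^ 2 ≤
      3 * (|L (1, 0, 0)| ^ 2 + |L (0, 1, 0)| ^ 2 + |L (0, 0, 1)| ^ 2) := by
    nlinarith [sq_nonneg (|L (1, 0, 0)| - |L (0, 1, 0)|), sq_nonneg (|L (0, 1, 0)| - |L (0, 0, 1)|),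
      sq_nonneg (|L (1, 0, 0)| - |L (0, 0, 1)|)]
  simp only [sq_abs] at h2
  exact h1.trans h2

/-- Sup norm of a triple. [folklore] -/
theorem norm_triple_eq_max (a b c : ℝ) : ‖((a, b, c) : ℝ × ℝ × ℝ)‖ = max |a| (max |b| |c|) := by
  simp [Prod.norm_def, Real.norm_eq_abs]

/-- **Registered sub-goal `corner_floor_dminus` (request R3): the gradient floor near the lattice of extremal minima in
distance-function form.** There are `r₁, c₁ > 0` such that for every `p ∈ ℝ³` with
`d₋ p = (1 − cos p.1) + (1 − cos p.2.2) + (1 + cos p.2.1) < r₁`: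
`c₁·d₋ p ≤ (fderiv Ω p (1,0,0))² + (fderiv Ω p (0,1,0))² + (fderiv Ω p (0,0,1))²`, `Ω q = resonanceFn ω₂ q.1 q.2.2 q.2.1`.
[folklore] -/
theorem corner_floor_dminus :
    ∀ ω₂ : ℝ, 0 < ω₂ → ∃ r₁ c₁ : ℝ, 0 < r₁ ∧ 0 < c₁ ∧ ∀ p : ℝ × ℝ × ℝ,
      (1 - Real.cos p.1) + (1 - Real.cos p.2.2) + (1 + Real.cos p.2.1) < r₁ →
      c₁ * ((1 - Real.cos p.1) + (1 - Real.cos p.2.2) + (1 + Real.cos p.2.1)) ≤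
        (fderiv ℝ (fun q : ℝ × ℝ × ℝ => resonanceFn ω₂ q.1 q.2.2 q.2.1) p (1, 0, 0)) ^ 2 +
          (fderiv ℝ (fun q : ℝ × ℝ × ℝ => resonanceFn ω₂ q.1 q.2.2 q.2.1) p (0, 1, 0)) ^ 2 +
          (fderiv ℝ (fun q : ℝ × ℝ × ℝ => resonanceFn ω₂ q.1 q.2.2 q.2.1) p (0, 0, 1)) ^ 2 := by
  intro ω₂ hω
  have hπ := Real.pi_pos
  obtain ⟨r, c, hr, hc, hcor⟩ := resonanceFn_gradient_floor_corner ω₂ hω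
  refine ⟨2 * r ^ 2 / Real.pi ^ 2, 2 * c ^ 2 / 9, by positivity, by positivity, fun p hd => ?_⟩
  set L := fderiv ℝ (fun q : ℝ × ℝ × ℝ => resonanceFn ω₂ q.1 q.2.2 q.2.1) p with hL
  -- reduce the coordinates
  obtain ⟨n₁, hn₁⟩ := exists_int_mem_Icc_sub_two_pi_mul p.1
  obtain ⟨n₂, hn₂⟩ := exists_int_mem_Icc_sub_two_pi_mul p.2.2
  obtain ⟨n₃, hn₃⟩ := exists_int_mem_Icc_sub_two_pi_mul (p.2.1 - Real.pi)
  set x₁ := p.1 - 2 * Real.pi * n₁ with hx₁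
  set x₂ := p.2.2 - 2 * Real.pi * n₂ with hx₂
  set x₃ := p.2.1 - Real.pi - 2 * Real.pi * n₃ with hx₃
  have habs₁ : |x₁| ≤ Real.pi := abs_le.2 ⟨hn₁.1, hn₁.2⟩
  have habs₂ : |x₂| ≤ Real.pi := abs_le.2 ⟨hn₂.1, hn₂.2⟩
  have habs₃ : |x₃| ≤ Real.pi := abs_le.2 ⟨hn₃.1, hn₃.2⟩
  have hc₁ : Real.cos p.1 = Real.cos x₁ := by
    rw [hx₁, show p.1 - 2 * Real.pi * n₁ = p.1 - n₁ * (2 * Real.pi) by ring, Real.cos_sub_int_mul_two_pi]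
  have hc₂ : Real.cos p.2.2 = Real.cos x₂ := by
    rw [hx₂, show p.2.2 - 2 * Real.pi * n₂ = p.2.2 - n₂ * (2 * Real.pi) by ring, Real.cos_sub_int_mul_two_pi]
  have hc₃ : Real.cos p.2.1 = -Real.cos x₃ := by
    rw [hx₃, show p.2.1 - Real.pi - 2 * Real.pi * n₃ = (p.2.1 - n₃ * (2 * Real.pi)) - Real.pi by ring,
      Real.cos_sub_pi, Real.cos_sub_int_mul_two_pi, neg_neg]
  -- the corner `p₀` and the sup distance
  have hnorm : ‖p - (2 * Real.pi * n₁, Real.pi + 2 * Real.pi * n₃, 2 * Real.pi * n₂)‖ = max |x₁| (max |x₃| |x₂|) := by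
    obtain ⟨a, b, c'⟩ := p
    simp only [Prod.mk_sub_mk]
    rw [norm_triple_eq_max]
    simp only [hx₁, hx₂, hx₃]
    congr 2
    ring_nf
  set m := max |x₁| (max |x₃| |x₂|) with hm
  have hm0 : 0 ≤ m := le_trans (abs_nonneg _) (le_max_left _ _)
  -- Jordan: `2 m² / π² ≤ d₋`
  have hJ₁ := Literature.Barriers.CriticalPhenomena.LongRangeIsing.two_mul_sq_div_le_one_sub_cos habs₁
  have hJ₂ := Literature.Barriers.CriticalPhenomena.LongRangeIsing.two_mul_sq_div_le_one_sub_cos habs₂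
  have hJ₃ := Literature.Barriers.CriticalPhenomena.LongRangeIsing.two_mul_sq_div_le_one_sub_cos habs₃
  have hd' : (1 - Real.cos p.1) + (1 - Real.cos p.2.2) + (1 + Real.cos p.2.1) =
      (1 - Real.cos x₁) + (1 - Real.cos x₂) + (1 - Real.cos x₃) := by rw [hc₁, hc₂, hc₃]; ring
  have hmsq : 2 * m ^ 2 / Real.pi ^ 2 ≤ (1 - Real.cos x₁) + (1 - Real.cos x₂) + (1 - Real.cos x₃) := by
    have h1 : 0 ≤ 1 - Real.cos x₁ := by linarith [Real.cos_le_one x₁]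
    have h2 : 0 ≤ 1 - Real.cos x₂ := by linarith [Real.cos_le_one x₂]
    have h3 : 0 ≤ 1 - Real.cos x₃ := by linarith [Real.cos_le_one x₃]
    have hmsq' : m ^ 2 = |x₁| ^ 2 ∨ m ^ 2 = |x₃| ^ 2 ∨ m ^ 2 = |x₂| ^ 2 := by
      rcases le_total |x₁| (max |x₃| |x₂|) with h | h
      · rcases le_total |x₃| |x₂| with h' | h'
        · right; right; rw [hm, max_eq_right h, max_eq_right h']
        · right; left; rw [hm, max_eq_right h, max_eq_left h']
      · left; rw [hm, max_eq_left h]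
    rcases hmsq' with h | h | h <;> rw [h, sq_abs] <;> linarith
  -- hence `‖p − p₀‖ < r`
  have hmr : m < r := by
    have h1 : 2 * m ^ 2 / Real.pi ^ 2 < 2 * r ^ 2 / Real.pi ^ 2 := by
      calc 2 * m ^ 2 / Real.pi ^ 2 ≤ _ := hmsq
        _ = (1 - Real.cos p.1) + (1 - Real.cos p.2.2) + (1 + Real.cos p.2.1) := hd'.symm
        _ < 2 * r ^ 2 / Real.pi ^ 2 := hd
    have h2 : m ^ 2 < r ^ 2 := by
      have hπ2 : 0 < Real.pi ^ 2 := by positivity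
      have := (div_lt_div_iff_of_pos_right hπ2).1 h1
      linarith
    exact lt_of_pow_lt_pow_left₀ 2 hr.le h2
  have hfl := (hcor n₁ n₂ n₃ p).1 (by rw [hnorm]; exact hmr)
  rw [hnorm] at hfl
  -- `d₋ ≤ (3/2) m²`
  have hdm : (1 - Real.cos x₁) + (1 - Real.cos x₂) + (1 - Real.cos x₃) ≤ 3 / 2 * m ^ 2 := by
    have h1 : 1 - Real.cos x₁ ≤ x₁ ^ 2 / 2 := by linarith [Real.one_sub_sq_div_two_le_cos (x := x₁)]
    have h2 : 1 - Real.cos x₂ ≤ x₂ ^ 2 / 2 := by linarith [Real.one_sub_sq_div_two_le_cos (x := x₂)]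
    have h3 : 1 - Real.cos x₃ ≤ x₃ ^ 2 / 2 := by linarith [Real.one_sub_sq_div_two_le_cos (x := x₃)]
    have e1 : x₁ ^ 2 ≤ m ^ 2 := by
      rw [← sq_abs x₁]; exact pow_le_pow_left₀ (abs_nonneg _) (le_max_left _ _) 2
    have e3 : x₃ ^ 2 ≤ m ^ 2 := by
      rw [← sq_abs x₃]
      exact pow_le_pow_left₀ (abs_nonneg _) (le_trans (le_max_left _ _) (le_max_right _ _)) 2
    have e2 : x₂ ^ 2 ≤ m ^ 2 := by
      rw [← sq_abs x₂]
      exact pow_le_pow_left₀ (abs_nonneg _) (le_trans (le_max_right _ _) (le_max_right _ _)) 2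
    linarith
  -- `‖L‖² ≤ 3 D`
  have hLD := opNorm_sq_le_three_mul_sum_sq L
  have hcm : (c * m) ^ 2 ≤ ‖L‖ ^ 2 := pow_le_pow_left₀ (by positivity) hfl 2
  rw [hd']
  have hc2 : 0 ≤ c ^ 2 := sq_nonneg c
  calc 2 * c ^ 2 / 9 * ((1 - Real.cos x₁) + (1 - Real.cos x₂) + (1 - Real.cos x₃))
      ≤ 2 * c ^ 2 / 9 * (3 / 2 * m ^ 2) := by gcongr
    _ = (c * m) ^ 2 / 3 := by ring
    _ ≤ ‖L‖ ^ 2 / 3 := by gcongr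
    _ ≤ _ := by rw [hL] at hLD ⊢; linarith

/-- **Registered sub-goal `corner_floor_dplus` (request R3): the gradient floor near the lattice of extremal maxima in
distance-function form.** There are `r₁, c₁ > 0` such that for every `p ∈ ℝ³` with
`d₊ p = (1 + cos p.1) + (1 + cos p.2.2) + (1 − cos p.2.1) < r₁`:
`c₁·d₊ p ≤ (fderiv Ω p (1,0,0))² + (fderiv Ω p (0,1,0))² + (fderiv Ω p (0,0,1))²`. [folklore] -/
theorem corner_floor_dplus :
    ∀ ω₂ : ℝ, 0 < ω₂ → ∃ r₁ c₁ : ℝ, 0 < r₁ ∧ 0 < c₁ ∧ ∀ p : ℝ × ℝ × ℝ,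
      (1 + Real.cos p.1) + (1 + Real.cos p.2.2) + (1 - Real.cos p.2.1) < r₁ →
      c₁ * ((1 + Real.cos p.1) + (1 + Real.cos p.2.2) + (1 - Real.cos p.2.1)) ≤
        (fderiv ℝ (fun q : ℝ × ℝ × ℝ => resonanceFn ω₂ q.1 q.2.2 q.2.1) p (1, 0, 0)) ^ 2 +
          (fderiv ℝ (fun q : ℝ × ℝ × ℝ => resonanceFn ω₂ q.1 q.2.2 q.2.1) p (0, 1, 0)) ^ 2 +
          (fderiv ℝ (fun q : ℝ × ℝ × ℝ => resonanceFn ω₂ q.1 q.2.2 q.2.1) p (0, 0, 1)) ^ 2 := by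
  intro ω₂ hω
  have hπ := Real.pi_pos
  obtain ⟨r, c, hr, hc, hcor⟩ := resonanceFn_gradient_floor_corner ω₂ hω
  refine ⟨2 * r ^ 2 / Real.pi ^ 2, 2 * c ^ 2 / 9, by positivity, by positivity, fun p hd => ?_⟩
  set L := fderiv ℝ (fun q : ℝ × ℝ × ℝ => resonanceFn ω₂ q.1 q.2.2 q.2.1) p with hL
  obtain ⟨n₁, hn₁⟩ := exists_int_mem_Icc_sub_two_pi_mul (p.1 - Real.pi)
  obtain ⟨n₂, hn₂⟩ := exists_int_mem_Icc_sub_two_pi_mul (p.2.2 - Real.pi)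
  obtain ⟨n₃, hn₃⟩ := exists_int_mem_Icc_sub_two_pi_mul p.2.1
  set x₁ := p.1 - Real.pi - 2 * Real.pi * n₁ with hx₁
  set x₂ := p.2.2 - Real.pi - 2 * Real.pi * n₂ with hx₂
  set x₃ := p.2.1 - 2 * Real.pi * n₃ with hx₃
  have habs₁ : |x₁| ≤ Real.pi := abs_le.2 ⟨hn₁.1, hn₁.2⟩
  have habs₂ : |x₂| ≤ Real.pi := abs_le.2 ⟨hn₂.1, hn₂.2⟩
  have habs₃ : |x₃| ≤ Real.pi := abs_le.2 ⟨hn₃.1, hn₃.2⟩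
  have hc₁ : Real.cos p.1 = -Real.cos x₁ := by
    rw [hx₁, show p.1 - Real.pi - 2 * Real.pi * n₁ = (p.1 - n₁ * (2 * Real.pi)) - Real.pi by ring,
      Real.cos_sub_pi, Real.cos_sub_int_mul_two_pi, neg_neg]
  have hc₂ : Real.cos p.2.2 = -Real.cos x₂ := by
    rw [hx₂, show p.2.2 - Real.pi - 2 * Real.pi * n₂ = (p.2.2 - n₂ * (2 * Real.pi)) - Real.pi by ring,
      Real.cos_sub_pi, Real.cos_sub_int_mul_two_pi, neg_neg]
  have hc₃ : Real.cos p.2.1 = Real.cos x₃ := by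
    rw [hx₃, show p.2.1 - 2 * Real.pi * n₃ = p.2.1 - n₃ * (2 * Real.pi) by ring, Real.cos_sub_int_mul_two_pi]
  have hnorm : ‖p - (Real.pi + 2 * Real.pi * n₁, 2 * Real.pi * n₃, Real.pi + 2 * Real.pi * n₂)‖ =
      max |x₁| (max |x₃| |x₂|) := by
    obtain ⟨a, b, c'⟩ := p
    simp only [Prod.mk_sub_mk]
    rw [norm_triple_eq_max]
    simp only [hx₁, hx₂, hx₃]
    congr 2
    · ring_nf
    · congr 1; ring_nf
  set m := max |x₁| (max |x₃| |x₂|) with hm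
  have hm0 : 0 ≤ m := le_trans (abs_nonneg _) (le_max_left _ _)
  have hJ₁ := Literature.Barriers.CriticalPhenomena.LongRangeIsing.two_mul_sq_div_le_one_sub_cos habs₁
  have hJ₂ := Literature.Barriers.CriticalPhenomena.LongRangeIsing.two_mul_sq_div_le_one_sub_cos habs₂
  have hJ₃ := Literature.Barriers.CriticalPhenomena.LongRangeIsing.two_mul_sq_div_le_one_sub_cos habs₃
  have hd' : (1 + Real.cos p.1) + (1 + Real.cos p.2.2) + (1 - Real.cos p.2.1) =
      (1 - Real.cos x₁) + (1 - Real.cos x₂) + (1 - Real.cos x₃) := by rw [hc₁, hc₂, hc₃]; ring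
  have hmsq : 2 * m ^ 2 / Real.pi ^ 2 ≤ (1 - Real.cos x₁) + (1 - Real.cos x₂) + (1 - Real.cos x₃) := by
    have h1 : 0 ≤ 1 - Real.cos x₁ := by linarith [Real.cos_le_one x₁]
    have h2 : 0 ≤ 1 - Real.cos x₂ := by linarith [Real.cos_le_one x₂]
    have h3 : 0 ≤ 1 - Real.cos x₃ := by linarith [Real.cos_le_one x₃]
    have hmsq' : m ^ 2 = |x₁| ^ 2 ∨ m ^ 2 = |x₃| ^ 2 ∨ m ^ 2 = |x₂| ^ 2 := by
      rcases le_total |x₁| (max |x₃| |x₂|) with h | h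
      · rcases le_total |x₃| |x₂| with h' | h'
        · right; right; rw [hm, max_eq_right h, max_eq_right h']
        · right; left; rw [hm, max_eq_right h, max_eq_left h']
      · left; rw [hm, max_eq_left h]
    rcases hmsq' with h | h | h <;> rw [h, sq_abs] <;> linarith
  have hmr : m < r := by
    have h1 : 2 * m ^ 2 / Real.pi ^ 2 < 2 * r ^ 2 / Real.pi ^ 2 := by
      calc 2 * m ^ 2 / Real.pi ^ 2 ≤ _ := hmsq
        _ = (1 + Real.cos p.1) + (1 + Real.cos p.2.2) + (1 - Real.cos p.2.1) := hd'.symm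
        _ < 2 * r ^ 2 / Real.pi ^ 2 := hd
    have h2 : m ^ 2 < r ^ 2 := by
      have hπ2 : 0 < Real.pi ^ 2 := by positivity
      have := (div_lt_div_iff_of_pos_right hπ2).1 h1
      linarith
    exact lt_of_pow_lt_pow_left₀ 2 hr.le h2
  have hfl := (hcor n₁ n₂ n₃ p).2 (by rw [hnorm]; exact hmr)
  rw [hnorm] at hfl
  have hdm : (1 - Real.cos x₁) + (1 - Real.cos x₂) + (1 - Real.cos x₃) ≤ 3 / 2 * m ^ 2 := by
    have h1 : 1 - Real.cos x₁ ≤ x₁ ^ 2 / 2 := by linarith [Real.one_sub_sq_div_two_le_cos (x := x₁)]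
    have h2 : 1 - Real.cos x₂ ≤ x₂ ^ 2 / 2 := by linarith [Real.one_sub_sq_div_two_le_cos (x := x₂)]
    have h3 : 1 - Real.cos x₃ ≤ x₃ ^ 2 / 2 := by linarith [Real.one_sub_sq_div_two_le_cos (x := x₃)]
    have e1 : x₁ ^ 2 ≤ m ^ 2 := by
      rw [← sq_abs x₁]; exact pow_le_pow_left₀ (abs_nonneg _) (le_max_left _ _) 2
    have e3 : x₃ ^ 2 ≤ m ^ 2 := by
      rw [← sq_abs x₃]
      exact pow_le_pow_left₀ (abs_nonneg _) (le_trans (le_max_left _ _) (le_max_right _ _)) 2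
    have e2 : x₂ ^ 2 ≤ m ^ 2 := by
      rw [← sq_abs x₂]
      exact pow_le_pow_left₀ (abs_nonneg _) (le_trans (le_max_right _ _) (le_max_right _ _)) 2
    linarith
  have hLD := opNorm_sq_le_three_mul_sum_sq L
  have hcm : (c * m) ^ 2 ≤ ‖L‖ ^ 2 := pow_le_pow_left₀ (by positivity) hfl 2
  rw [hd']
  have hc2 : 0 ≤ c ^ 2 := sq_nonneg c
  calc 2 * c ^ 2 / 9 * ((1 - Real.cos x₁) + (1 - Real.cos x₂) + (1 - Real.cos x₃))
      ≤ 2 * c ^ 2 / 9 * (3 / 2 * m ^ 2) := by gcongr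
    _ = (c * m) ^ 2 / 3 := by ring
    _ ≤ ‖L‖ ^ 2 / 3 := by gcongr
    _ ≤ _ := by rw [hL] at hLD ⊢; linarith

end Summit.AtomisticToContinuum.FouriersLaw.Theorems.DrudeDissolution.KineticPolymerGasOnTheTimeAxis

end
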